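import Literature.Combinatorics.SimpleGraph.LittleTheorem
import Literature.Combinatorics.SimpleGraph.LittleTheoremReduction
import Literature.Combinatorics.SimpleGraph.LittleDigonCase
import Literature.Combinatorics.SimpleGraph.NonCutVertex
import Literature.Combinatorics.SimpleGraph.MinimallyStrongBound
import Literature.Combinatorics.SimpleGraph.LittleVertexCrossRatio
import HarnessLib

/-!
# Little's theorem: the core, and the discharge of the named fact

Topic `Combinatorics/SimpleGraph`; theorems only. Assembly of the hard direction of Little's
theorem (`Little1975_isPfaffianBipartite_iff_not_isMatchingMinor`, `LittleTheorem.lean`):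

* `LittleTheoremReduction.lean` reduces it to the CORE — a non-Pfaffian `G ⊇ diagonal` all of
  whose one-edge-deleted subgraphs and proper central subgraphs are Pfaffian and all of whose rows
  and columns have `≥ 3` entries has a `K_{3,3}` matching minor;
* `LittleDigonCase.lean` settles the CORE when the digraph `D(G, M)` has a directed 2-circuit;
* otherwise (`NonCutVertex.lean`) some vertex `y` of the strongly connected, 2-diregular digraph
  `D(G, M)`, all of whose arcs are removable (`LittleCoreDegrees.lean`), is not a cut vertex;
  moving `y` to `0` (a simultaneous relabelling of rows and columns) the minor `K` at `0` has a
  strongly connected digraph `D(K) = D(G, M) − 0`, in which, by the cross-ratio argument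
  (`LittleVertexCrossRatio.lean`: (α), (β), (γ)), NO arc is removable; a minimally strongly
  connected digon-free digraph on `m` vertices has `≤ 2m - 3` arcs (`MinimallyStrongBound.lean`),
  but `D(K)` has `2(m + 1) - 4 = 2m - 2`: contradiction.

Main results: `core_holds` (the CORE statement, unconditionally) and the discharge
`Little1975_isPfaffianBipartite_iff_not_isMatchingMinor_holds`.

## References

* C. H. C. Little, *A characterization of convertible (0,1)-matrices*, J. Combin. Theory Ser. B
  18 (1975) 187–208, Theorem 1, §4. [Little1975]
* P. D. Seymour, C. Thomassen, *Characterization of even directed graphs*, J. Combin. Theory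
  Ser. B 42 (1987) 36–45, §4. [SeymourThomassen1987]
* N. Robertson, P. D. Seymour, R. Thomas, *Permanents, Pfaffian orientations, and even directed
  circuits*, Ann. of Math. 150 (1999) 929–975, §7. [RobertsonSeymourThomas1999]
-/

namespace Literature.Combinatorics.SimpleGraph

open Equiv Finset

/-! ### Generic helpers -/

section Helpers

variable {n : ℕ} {G : Finset (Fin n × Fin n)}

/-- Mapping reachability along a function compatible with the relations. [folklore] -/
theorem reflTransGen_map {α β : Type*} {r : α → α → Prop} {p : β → β → Prop} (f : α → β)
    (h : ∀ a b, r a b → p (f a) (f b)) {a b : α} (hab : Relation.ReflTransGen r a b) :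
    Relation.ReflTransGen p (f a) (f b) := by
  induction hab with
  | refl => exact Relation.ReflTransGen.refl
  | tail _ hbc ih => exact ih.tail (h _ _ hbc)

/-- Two distinct out-neighbours and at most two out-neighbours: exactly two, as a list.
[folklore] -/
theorem exists_two_iff_of_le_two {x : Fin n} (h2 : ∃ y₁ y₂, y₁ ≠ y₂ ∧ IsArc G x y₁ ∧ IsArc G x y₂)
    (hle : ∃ p q : Fin n, ∀ w, IsArc G x w → w = p ∨ w = q) :
    ∃ p₁ p₂, p₁ ≠ p₂ ∧ ∀ w, IsArc G x w ↔ w = p₁ ∨ w = p₂ := by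
  obtain ⟨y₁, y₂, hne, hy₁, hy₂⟩ := h2
  obtain ⟨p, q, hpq⟩ := hle
  refine ⟨y₁, y₂, hne, fun w => ⟨fun hw => ?_, fun hw => ?_⟩⟩
  · rcases hpq w hw with rfl | rfl <;> rcases hpq y₁ hy₁ with h₁ | h₁ <;>
      rcases hpq y₂ hy₂ with h₂ | h₂
    all_goals first
      | exact Or.inl h₁.symm
      | exact Or.inr h₂.symm
      | exact absurd (h₁.trans h₂.symm) hne
  · rcases hw with rfl | rfl
    exacts [hy₁, hy₂]

/-- The same for in-neighbours. [folklore] -/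
theorem exists_two_iff_of_le_two_in {x : Fin n}
    (h2 : ∃ y₁ y₂, y₁ ≠ y₂ ∧ IsArc G y₁ x ∧ IsArc G y₂ x)
    (hle : ∃ p q : Fin n, ∀ w, IsArc G w x → w = p ∨ w = q) :
    ∃ u₁ u₂, u₁ ≠ u₂ ∧ ∀ w, IsArc G w x ↔ w = u₁ ∨ w = u₂ := by
  obtain ⟨y₁, y₂, hne, hy₁, hy₂⟩ := h2
  obtain ⟨p, q, hpq⟩ := hle
  refine ⟨y₁, y₂, hne, fun w => ⟨fun hw => ?_, fun hw => ?_⟩⟩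
  · rcases hpq w hw with rfl | rfl <;> rcases hpq y₁ hy₁ with h₁ | h₁ <;>
      rcases hpq y₂ hy₂ with h₂ | h₂
    all_goals first
      | exact Or.inl h₁.symm
      | exact Or.inr h₂.symm
      | exact absurd (h₁.trans h₂.symm) hne
  · rcases hw with rfl | rfl
    exacts [hy₁, hy₂]

/-- Exactly two out-neighbours means out-degree `2`. [folklore] -/
theorem card_filter_isArc_eq_two {x : Fin n} {p₁ p₂ : Fin n} (hne : p₁ ≠ p₂)
    (h : ∀ w, IsArc G x w ↔ w = p₁ ∨ w = p₂) :
    (Finset.univ.filter fun w => IsArc G x w).card = 2 := by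
  classical
  have : (Finset.univ.filter fun w => IsArc G x w) = {p₁, p₂} := by
    ext w; simp [h]
  rw [this, Finset.card_pair hne]

/-- Exactly two in-neighbours means in-degree `2`. [folklore] -/
theorem card_filter_isArc_in_eq_two {x : Fin n} {u₁ u₂ : Fin n} (hne : u₁ ≠ u₂)
    (h : ∀ w, IsArc G w x ↔ w = u₁ ∨ w = u₂) :
    (Finset.univ.filter fun w => IsArc G w x).card = 2 := by
  classical
  have : (Finset.univ.filter fun w => IsArc G w x) = {u₁, u₂} := by
    ext w; simp [h]
  rw [this, Finset.card_pair hne]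

end Helpers

/-! ### The minor at `0`: paths and strong connectivity -/

section MinorZero

variable {m : ℕ} {G : Finset (Fin (m + 1) × Fin (m + 1))}

/-- Arcs of the minor at `0` are arcs of `G` between the successor vertices. [folklore] -/
theorem isArc_succ_of_isArc_minorZero {c d : Fin m}
    (h : IsArc (Finset.univ.filter fun e : Fin m × Fin m => (e.1.succ, e.2.succ) ∈ G) c d) :
    IsArc G c.succ d.succ :=
  ⟨fun heq => h.1 (Fin.succ_injective _ heq), (Finset.mem_filter.1 h.2).2⟩

/-- The same after deleting an arc. [folklore] -/
theorem isArc_succ_of_isArc_minorZero_erase {a b c d : Fin m}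
    (h : IsArc ((Finset.univ.filter fun e : Fin m × Fin m => (e.1.succ, e.2.succ) ∈ G).erase (a, b))
      c d) :
    IsArc (G.erase (a.succ, b.succ)) c.succ d.succ := by
  rw [isArc_erase_iff] at h ⊢
  refine ⟨isArc_succ_of_isArc_minorZero h.1, fun heq => h.2 ?_⟩
  obtain ⟨h1, h2⟩ := Prod.ext_iff.1 heq
  exact Prod.ext (Fin.succ_injective _ h1) (Fin.succ_injective _ h2)

/-- **A directed path of the minor at `0` is a directed path of `D − 0`.** From strong
connectivity of `K'` (the minor, possibly with an arc deleted) we get, for all `c, d`, a list over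
`Fin (m+1)` which is a chain of arcs of `G''`, without repetitions, avoiding the vertex `0`, from
`c.succ` to `d.succ`. [folklore] -/
theorem exists_succPath {K' : Finset (Fin m × Fin m)} {G'' : Finset (Fin (m + 1) × Fin (m + 1))}
    (hKG : ∀ c d, IsArc K' c d → IsArc G'' c.succ d.succ) (hs : IsStrong K') (c d : Fin m) :
    ∃ L : List (Fin (m + 1)), L.IsChain (IsArc G'') ∧ L.Nodup ∧ (∀ x ∈ L, x ≠ 0) ∧
      L.head? = some c.succ ∧ L.getLast? = some d.succ := by
  obtain ⟨l, hc, hnd, hlast⟩ := hs.exists_path c d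
  refine ⟨(c :: l).map Fin.succ, ?_, hnd.map (Fin.succ_injective _), ?_, rfl, ?_⟩
  · rw [List.isChain_map]
    exact List.IsChain.imp (fun a b hab => hKG a b hab) hc
  · intro x hx
    obtain ⟨y, -, rfl⟩ := List.mem_map.1 hx
    exact Fin.succ_ne_zero _
  · rw [List.getLast?_map, List.getLast?_eq_getLast_of_ne_nil (List.cons_ne_nil _ _), hlast]
    rfl

/-- **`D − 0` strongly connected (every two vertices `≠ 0` joined by a directed path avoiding
`0`) means that the minor at `0` has a strongly connected digraph.** [folklore] -/
theorem isStrong_minorZero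
    (h0 : ∀ a b : Fin (m + 1), a ≠ 0 → b ≠ 0 →
      Relation.ReflTransGen (fun c d => IsArc G c d ∧ c ≠ 0 ∧ d ≠ 0) a b) :
    IsStrong (Finset.univ.filter fun e : Fin m × Fin m => (e.1.succ, e.2.succ) ∈ G) := by
  intro c d
  -- map a path of `D − 0` down along `Fin.pred`
  have key : ∀ a b : Fin (m + 1), Relation.ReflTransGen (fun c d => IsArc G c d ∧ c ≠ 0 ∧ d ≠ 0) a b →
      ∀ (ha : a ≠ 0) (hb : b ≠ 0),
        Relation.ReflTransGen (IsArc (Finset.univ.filter fun e : Fin m × Fin m =>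
          (e.1.succ, e.2.succ) ∈ G)) (a.pred ha) (b.pred hb) := by
    intro a b hab
    induction hab with
    | refl => intro ha hb; exact Relation.ReflTransGen.refl
    | tail _ hbc ih =>
      intro ha hc
      obtain ⟨harc, hb0, hc0⟩ := hbc
      refine (ih ha hb0).tail ⟨fun h => harc.1 ?_, Finset.mem_filter.2 ⟨Finset.mem_univ _, ?_⟩⟩
      · have := congrArg Fin.succ h
        simpa using this
      · simpa using harc.2
  have h := key c.succ d.succ (h0 _ _ (Fin.succ_ne_zero _) (Fin.succ_ne_zero _))
    (Fin.succ_ne_zero _) (Fin.succ_ne_zero _)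
  simpa using h

/-! ### No arc of the minor at `0` is removable -/

/-- **The cross-ratio contradiction.** Let `G ⊇ diagonal` (on `Fin (m+1)`) be non-Pfaffian,
with `G.erase e` Pfaffian for every `e ∈ G`, with Pfaffian minor at `0`, digon-free digraph,
vertex `0` having exactly the out-neighbours `p₁ ≠ p₂` and in-neighbours `u₁ ≠ u₂`, and strongly
connected minor `K` at `0`. Then no arc `(a, b)` of `K` can be deleted keeping `D(K)` strongly
connected (by (α), (β), (γ) of `LittleVertexCrossRatio.lean`). [cite: Little1975, Theorem 1] -/
theorem not_isStrong_minorZero_erase (hdiag : ∀ i, (i, i) ∈ G) (hG : ¬ IsPfaffianBipartite G)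
    (hdel : ∀ e ∈ G, IsPfaffianBipartite (G.erase e))
    (hK : IsPfaffianBipartite (Finset.univ.filter fun e : Fin m × Fin m => (e.1.succ, e.2.succ) ∈ G))
    (hnodig : ∀ u v, IsArc G u v → ¬ IsArc G v u)
    {p₁ p₂ u₁ u₂ : Fin (m + 1)} (hp : ∀ c, IsArc G 0 c ↔ c = p₁ ∨ c = p₂)
    (hu : ∀ c, IsArc G c 0 ↔ c = u₁ ∨ c = u₂) (hp12 : p₁ ≠ p₂) (hu12 : u₁ ≠ u₂)
    (hsK : IsStrong (Finset.univ.filter fun e : Fin m × Fin m => (e.1.succ, e.2.succ) ∈ G))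
    {a b : Fin m}
    (hab : IsArc (Finset.univ.filter fun e : Fin m × Fin m => (e.1.succ, e.2.succ) ∈ G) a b)
    (hsKe : IsStrong ((Finset.univ.filter fun e : Fin m × Fin m =>
      (e.1.succ, e.2.succ) ∈ G).erase (a, b))) : False := by
  classical
  set K := Finset.univ.filter fun e : Fin m × Fin m => (e.1.succ, e.2.succ) ∈ G with hKdef
  -- the signing of the minor at `0`
  obtain ⟨t, ht1, -, -, htpos⟩ := exists_signing_of_minorZero hdiag hK
  have htposc : ∀ σ : Perm (Fin (m + 1)), σ.IsCycle → (∀ i, (i, σ i) ∈ G) → σ 0 = 0 →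
      Perm.sign σ * ∏ i, t (i, σ i) = 1 := fun σ _ hσ h0 => htpos σ hσ h0
  -- the ports
  have hp₁ : IsArc G 0 p₁ := (hp p₁).2 (Or.inl rfl)
  have hp₂ : IsArc G 0 p₂ := (hp p₂).2 (Or.inr rfl)
  have hu₁ : IsArc G u₁ 0 := (hu u₁).2 (Or.inl rfl)
  have hu₂ : IsArc G u₂ 0 := (hu u₂).2 (Or.inr rfl)
  have hpu : ∀ p u, IsArc G 0 p → IsArc G u 0 → p ≠ u := by
    rintro p u h1 h2 rfl; exact hnodig _ _ h1 h2
  -- Pólya signings of one-edge-deleted subgraphs, in circuit form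
  have hsig : ∀ e ∈ G, e.1 ≠ e.2 → ∃ s : Fin (m + 1) × Fin (m + 1) → ℤˣ, (∀ i, s (i, i) = 1) ∧
      ∀ σ : Perm (Fin (m + 1)), σ.IsCycle → (∀ i, (i, σ i) ∈ G.erase e) →
        Perm.sign σ * ∏ i, s (i, σ i) = 1 := by
    intro e he hne
    have hdiag' : ∀ i, (i, i) ∈ G.erase e := fun i =>
      Finset.mem_erase.2 ⟨fun h => hne (by rw [← h]), hdiag i⟩
    obtain ⟨s, hs1, hspos⟩ := (isPfaffianBipartite_iff_forall_isCycle hdiag').1 (hdel e he)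
    exact ⟨s, hs1, hspos⟩
  -- (α): circuits through `0` with the same ports have the same `t`-weight
  have hclass : ∀ γ γ' : Perm (Fin (m + 1)), γ.IsCycle → (∀ i, (i, γ i) ∈ G) → γ'.IsCycle →
      (∀ i, (i, γ' i) ∈ G) → γ 0 ≠ 0 → γ 0 = γ' 0 → γ.symm 0 = γ'.symm 0 →
      Perm.sign γ * ∏ i, t (i, γ i) = Perm.sign γ' * ∏ i, t (i, γ' i) := by
    intro γ γ' hγ hγmem hγ' hγ'mem h0 h00 hss
    have hγu : γ (γ.symm 0) = 0 := Equiv.apply_symm_apply _ _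
    have hγ'u : γ' (γ.symm 0) = 0 := by rw [hss]; exact Equiv.apply_symm_apply _ _
    have hu0 : γ.symm 0 ≠ 0 := fun h => h0 (by rw [h] at hγu; exact hγu)
    have hparc : IsArc G 0 (γ 0) := ⟨Ne.symm h0, hγmem 0⟩
    have huarc : IsArc G (γ.symm 0) 0 := ⟨hu0, by simpa only [hγu] using hγmem (γ.symm 0)⟩
    have hup : γ.symm 0 ≠ γ 0 := (hpu _ _ hparc huarc).symm
    -- the other in-neighbour `u'`
    obtain ⟨u', hu'arc, huu'⟩ : ∃ u', IsArc G u' 0 ∧ γ.symm 0 ≠ u' := by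
      rcases (hu _).1 huarc with h | h
      · exact ⟨u₂, hu₂, by rw [h]; exact hu12⟩
      · exact ⟨u₁, hu₁, by rw [h]; exact hu12.symm⟩
    obtain ⟨s, hs1, hspos⟩ := hsig (u', 0) hu'arc.2 hu'arc.1
    have hspos' : ∀ σ : Perm (Fin (m + 1)), σ.IsCycle → (∀ i, (i, σ i) ∈ G) → σ u' ≠ 0 →
        Perm.sign σ * ∏ i, s (i, σ i) = 1 := by
      intro σ hσ hσmem hσu'
      refine hspos σ hσ fun i => Finset.mem_erase.2 ⟨fun h => ?_, hσmem i⟩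
      obtain ⟨h1, h2⟩ := Prod.ext_iff.1 h
      simp only at h1 h2
      rw [h1] at h2
      exact hσu' h2
    -- the return path from `u` to `p` in `D − 0`
    obtain ⟨L, hLc, -, hL0, hLh, hLl⟩ := exists_succPath (G'' := G)
      (fun c d h => isArc_succ_of_isArc_minorZero h) hsK ((γ.symm 0).pred hu0) ((γ 0).pred (Ne.symm h0 ∘ Eq.symm))
    rw [Fin.succ_pred] at hLh hLl
    obtain ⟨lT, rfl⟩ : ∃ lT, L = γ.symm 0 :: lT := by
      cases L with
      | nil => simp at hLh
      | cons x lT => exact ⟨lT, by simpa using hLh⟩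
    have hTlast : (γ.symm 0 :: lT).getLast (List.cons_ne_nil _ _) = γ 0 := by
      rw [List.getLast?_eq_getLast_of_ne_nil (List.cons_ne_nil _ _), Option.some_inj] at hLl
      exact hLl
    exact weight_eq_of_same_ports hdiag ht1 htposc hs1 hu'arc.1 hspos' hγ hγmem hγ' hγ'mem hu0 hup
      huu' hγu rfl hγ'u h00.symm hLc hL0 hTlast
  -- (β)
  have hβ := fun C₁₁ C₁₂ C₂₁ C₂₂ h₁₁ h₁₂ h₂₁ h₂₂ =>
    prod_weights_eq_neg_one hdiag hG ht1 htposc hp hu hp12 hu12 hclass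
      (C₁₁ := C₁₁) (C₁₂ := C₁₂) (C₂₁ := C₂₁) (C₂₂ := C₂₂) h₁₁ h₁₂ h₂₁ h₂₂
  -- the deleted arc `g = (a.succ, b.succ)` and its Pólya signing
  have hgarc : IsArc G a.succ b.succ := isArc_succ_of_isArc_minorZero hab
  obtain ⟨sg, hsg1, hsgpos⟩ := hsig (a.succ, b.succ) hgarc.2 hgarc.1
  -- the six paths of `D − 0 − g`
  have hpaths := fun c d => exists_succPath (G'' := G.erase (a.succ, b.succ))
    (fun c d h => isArc_succ_of_isArc_minorZero_erase h) hsKe c d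
  have hp₁0 : p₁ ≠ 0 := hp₁.1.symm
  have hp₂0 : p₂ ≠ 0 := hp₂.1.symm
  obtain ⟨P₁₁, hP₁₁⟩ := hpaths (p₁.pred hp₁0) (u₁.pred hu₁.1)
  obtain ⟨P₁₂, hP₁₂⟩ := hpaths (p₁.pred hp₁0) (u₂.pred hu₂.1)
  obtain ⟨P₂₁, hP₂₁⟩ := hpaths (p₂.pred hp₂0) (u₁.pred hu₁.1)
  obtain ⟨P₂₂, hP₂₂⟩ := hpaths (p₂.pred hp₂0) (u₂.pred hu₂.1)
  obtain ⟨T₁, hT₁c, -, hT₁0, hT₁h, hT₁l⟩ := hpaths (u₁.pred hu₁.1) (p₂.pred hp₂0)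
  obtain ⟨T₂, hT₂c, -, hT₂0, hT₂h, hT₂l⟩ := hpaths (u₂.pred hu₂.1) (p₁.pred hp₁0)
  simp only [Fin.succ_pred] at hP₁₁ hP₁₂ hP₂₁ hP₂₂ hT₁h hT₁l hT₂h hT₂l
  exact false_of_paths_avoiding hdiag ht1 htposc (g := (a.succ, b.succ)) hgarc.1 (Fin.succ_ne_zero _)
    (Fin.succ_ne_zero _) hsg1 hsgpos hp₁ hp₂ hu₁ hu₂ (hpu _ _ hp₁ hu₁) (hpu _ _ hp₁ hu₂)
    (hpu _ _ hp₂ hu₁) (hpu _ _ hp₂ hu₂) hβ hP₁₁ hP₁₂ hP₂₁ hP₂₂ ⟨hT₁c, hT₁0, hT₁h, hT₁l⟩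
    ⟨hT₂c, hT₂0, hT₂h, hT₂l⟩

/-! ### Counting the arcs of the minor at `0` -/

/-- **The minor at `0` has four arcs fewer than `D(G, M)`**: the two out-arcs and the two in-arcs
of `0`. [folklore] -/
theorem card_arcs_minorZero_add_four {p₁ p₂ u₁ u₂ : Fin (m + 1)}
    (hp : ∀ c, IsArc G 0 c ↔ c = p₁ ∨ c = p₂) (hu : ∀ c, IsArc G c 0 ↔ c = u₁ ∨ c = u₂)
    (hp12 : p₁ ≠ p₂) (hu12 : u₁ ≠ u₂) :
    (Finset.univ.filter fun e : Fin m × Fin m =>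
        IsArc (Finset.univ.filter fun e : Fin m × Fin m => (e.1.succ, e.2.succ) ∈ G) e.1 e.2).card + 4 =
      (Finset.univ.filter fun e : Fin (m + 1) × Fin (m + 1) => IsArc G e.1 e.2).card := by
  classical
  set K := Finset.univ.filter fun e : Fin m × Fin m => (e.1.succ, e.2.succ) ∈ G with hKdef
  set arcsG := Finset.univ.filter fun e : Fin (m + 1) × Fin (m + 1) => IsArc G e.1 e.2 with harcsG
  have hp₁0 : p₁ ≠ 0 := ((hp p₁).2 (Or.inl rfl)).1.symm
  have hp₂0 : p₂ ≠ 0 := ((hp p₂).2 (Or.inr rfl)).1.symm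
  have hu₁0 : u₁ ≠ 0 := ((hu u₁).2 (Or.inl rfl)).1
  have hu₂0 : u₂ ≠ 0 := ((hu u₂).2 (Or.inr rfl)).1
  rw [← Finset.card_filter_add_card_filter_not (s := arcsG) (fun e => e.1 ≠ 0 ∧ e.2 ≠ 0)]
  congr 1
  · -- arcs between vertices `≠ 0`: the image of the arcs of `K`
    have hφ : Function.Injective fun e : Fin m × Fin m => ((e.1.succ, e.2.succ) : Fin (m + 1) × Fin (m + 1)) :=
      fun e e' h => Prod.ext (Fin.succ_injective _ (Prod.ext_iff.1 h).1)
        (Fin.succ_injective _ (Prod.ext_iff.1 h).2)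
    rw [← Finset.card_map ⟨_, hφ⟩]
    congr 1
    ext e
    simp only [Finset.mem_filter, Finset.mem_univ, true_and, Finset.mem_map,
      Function.Embedding.coeFn_mk, harcsG]
    constructor
    · rintro ⟨c, hc, rfl⟩
      have h := isArc_succ_of_isArc_minorZero hc
      exact ⟨h, Fin.succ_ne_zero _, Fin.succ_ne_zero _⟩
    · rintro ⟨harc, h1, h2⟩
      refine ⟨(e.1.pred h1, e.2.pred h2), ⟨fun h => harc.1 ?_, Finset.mem_filter.2
        ⟨Finset.mem_univ _, ?_⟩⟩, ?_⟩
      · simpa using congrArg Fin.succ h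
      · simpa using harc.2
      · simp
  · -- arcs at `0`
    have hset : arcsG.filter (fun e => ¬ (e.1 ≠ 0 ∧ e.2 ≠ 0)) =
        {((0 : Fin (m + 1)), p₁), (0, p₂), (u₁, 0), (u₂, 0)} := by
      ext e
      simp only [Finset.mem_filter, Finset.mem_univ, true_and, harcsG, Finset.mem_insert,
        Finset.mem_singleton, not_and_or, not_not]
      constructor
      · rintro ⟨harc, h | h⟩
        · have h2 : e.2 = p₁ ∨ e.2 = p₂ := (hp e.2).1 (by rw [← h]; exact harc)
          rcases h2 with h2 | h2
          · exact Or.inl (Prod.ext h h2)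
          · exact Or.inr (Or.inl (Prod.ext h h2))
        · have h1 : e.1 = u₁ ∨ e.1 = u₂ := (hu e.1).1 (by rw [← h]; exact harc)
          rcases h1 with h1 | h1
          · exact Or.inr (Or.inr (Or.inl (Prod.ext h1 h)))
          · exact Or.inr (Or.inr (Or.inr (Prod.ext h1 h)))
      · rintro (rfl | rfl | rfl | rfl)
        · exact ⟨(hp p₁).2 (Or.inl rfl), Or.inl rfl⟩
        · exact ⟨(hp p₂).2 (Or.inr rfl), Or.inl rfl⟩
        · exact ⟨(hu u₁).2 (Or.inl rfl), Or.inr rfl⟩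
        · exact ⟨(hu u₂).2 (Or.inr rfl), Or.inr rfl⟩
    rw [hset, Finset.card_insert_of_notMem, Finset.card_insert_of_notMem, Finset.card_pair]
    · simp [Prod.ext_iff, hu12]
    · simp [Prod.ext_iff, hp₂0, hu₁0.symm, hu₂0.symm]
    · simp [Prod.ext_iff, hp12, hp₁0, hu₁0.symm, hu₂0.symm]

/-! ### The contradiction at a non-cut vertex -/

/-- The digraph facts of a minimal non-Pfaffian `G ⊇ diagonal` with all degrees `≥ 3`: strongly
connected, every arc removable, every vertex with exactly two out- and two in-neighbours.
[cite: SeymourThomassen1987, §4 (1)–(4)] -/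
theorem core_digraph_facts {n : ℕ} {G : Finset (Fin n × Fin n)} (hdiag : ∀ i, (i, i) ∈ G)
    (hG : ¬ IsPfaffianBipartite G) (hdel : ∀ e ∈ G, IsPfaffianBipartite (G.erase e))
    (hrow : ∀ i, 3 ≤ (G.filter fun e : Fin n × Fin n => e.1 = i).card)
    (hcol : ∀ j, 3 ≤ (G.filter fun e : Fin n × Fin n => e.2 = j).card) :
    IsStrong G ∧ (∀ a b, IsArc G a b → IsStrong (G.erase (a, b))) ∧
      (∀ x, ∃ p₁ p₂, p₁ ≠ p₂ ∧ ∀ w, IsArc G x w ↔ w = p₁ ∨ w = p₂) ∧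
      (∀ x, ∃ u₁ u₂, u₁ ≠ u₂ ∧ ∀ w, IsArc G w x ↔ w = u₁ ∨ w = u₂) := by
  have hout2 : ∀ x : Fin n, ∃ y₁ y₂, y₁ ≠ y₂ ∧ IsArc G x y₁ ∧ IsArc G x y₂ := fun x =>
    exists_two_isArc_of_three_le_card x (hdiag x) (hrow x)
  have hin2 : ∀ x : Fin n, ∃ y₁ y₂, y₁ ≠ y₂ ∧ IsArc G y₁ x ∧ IsArc G y₂ x := fun x =>
    exists_two_isArc_in_of_three_le_card x (hdiag x) (hcol x)
  have hs : IsStrong G :=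
    isStrong_of_deletionMinimal hdiag hG hdel fun x => let ⟨y, _, _, hy, _⟩ := hout2 x; ⟨y, hy⟩
  by_cases hn : n = 0
  · subst hn
    exact ⟨hs, fun a => a.elim0, fun x => x.elim0, fun x => x.elim0⟩
  obtain ⟨x₀⟩ : Nonempty (Fin n) := ⟨⟨0, Nat.pos_of_ne_zero hn⟩⟩
  have h₀ := exists_isArc_isStrong_erase hs x₀ hout2
  have hrem : ∀ a b, IsArc G a b → IsStrong (G.erase (a, b)) := fun a b hab =>
    isStrong_erase_of_exists hdiag hG hdel hs hout2 h₀ hab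
  refine ⟨hs, hrem, fun x => ?_, fun x => ?_⟩
  · exact exists_two_iff_of_le_two (hout2 x) (outNeighbours_le_two hdiag hG hdel hrem x
      (let ⟨y, _, _, hy, _⟩ := hin2 x; ⟨y, hy⟩))
  · exact exists_two_iff_of_le_two_in (hin2 x) (inNeighbours_le_two hdiag hG hdel hrem x
      (let ⟨y, _, _, hy, _⟩ := hout2 x; ⟨y, hy⟩))

/-- **A minimal non-Pfaffian `G ⊇ diagonal` with all degrees `≥ 3` and digon-free digraph cannot
have `0` as a non-cut vertex**: otherwise the minor at `0` would be minimally strongly connected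
(`not_isStrong_minorZero_erase`) with `2(m + 1) - 4` arcs (`card_arcs_minorZero_add_four`),
more than the `2m - 3` allowed by `card_arcs_le_of_minimallyStrong`.
[cite: Little1975, Theorem 1] -/
theorem false_of_nonCut_zero (hdiag : ∀ i, (i, i) ∈ G) (hG : ¬ IsPfaffianBipartite G)
    (hdel : ∀ e ∈ G, IsPfaffianBipartite (G.erase e))
    (hcen : ∀ (k : ℕ) (K : Finset (Fin k × Fin k)), k < m + 1 → IsCentralSubgraph K G →
      IsPfaffianBipartite K)
    (hrow : ∀ i, 3 ≤ (G.filter fun e : Fin (m + 1) × Fin (m + 1) => e.1 = i).card)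
    (hcol : ∀ j, 3 ≤ (G.filter fun e : Fin (m + 1) × Fin (m + 1) => e.2 = j).card)
    (hnodig : ∀ u v, IsArc G u v → ¬ IsArc G v u)
    (h0 : ∀ a b : Fin (m + 1), a ≠ 0 → b ≠ 0 →
      Relation.ReflTransGen (fun c d => IsArc G c d ∧ c ≠ 0 ∧ d ≠ 0) a b) : False := by
  classical
  set K := Finset.univ.filter fun e : Fin m × Fin m => (e.1.succ, e.2.succ) ∈ G with hKdef
  obtain ⟨hs, hrem, hout, hin⟩ := core_digraph_facts hdiag hG hdel hrow hcol
  obtain ⟨p₁, p₂, hp12, hp⟩ := hout 0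
  obtain ⟨u₁, u₂, hu12, hu⟩ := hin 0
  have hp₁ : IsArc G 0 p₁ := (hp p₁).2 (Or.inl rfl)
  have hp₂ : IsArc G 0 p₂ := (hp p₂).2 (Or.inr rfl)
  have hu₁ : IsArc G u₁ 0 := (hu u₁).2 (Or.inl rfl)
  have hsK : IsStrong K := isStrong_minorZero h0
  have hKc : IsPfaffianBipartite K :=
    hcen m K (lt_add_one m) (isCentralSubgraph_minorZero (hdiag 0))
  have hminK : ∀ a b, IsArc K a b → ¬ IsStrong (K.erase (a, b)) := fun a b hab hs' =>
    not_isStrong_minorZero_erase hdiag hG hdel hKc hnodig hp hu hp12 hu12 hsK hab hs'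
  have hnodigK : ∀ a b, IsArc K a b → ¬ IsArc K b a := fun a b hab hba =>
    hnodig _ _ (isArc_succ_of_isArc_minorZero hab) (isArc_succ_of_isArc_minorZero hba)
  -- `m ≥ 3`: `0, p₁, p₂, u₁` are distinct
  have hm3 : 3 ≤ m := by
    have hu₁p₁ : u₁ ≠ p₁ := fun h => hnodig _ _ hp₁ (h ▸ hu₁)
    have hu₁p₂ : u₁ ≠ p₂ := fun h => hnodig _ _ hp₂ (h ▸ hu₁)
    have hcard : ({(0 : Fin (m + 1)), p₁, p₂, u₁} : Finset (Fin (m + 1))).card = 4 := by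
      rw [Finset.card_insert_of_notMem, Finset.card_insert_of_notMem, Finset.card_pair hu₁p₂.symm]
      · simp [hp12, hu₁p₁.symm]
      · simp [hp₁.1, hp₂.1, hu₁.1.symm]
    have := Finset.card_le_univ ({(0 : Fin (m + 1)), p₁, p₂, u₁} : Finset (Fin (m + 1)))
    rw [hcard, Fintype.card_fin] at this
    omega
  have hbound := card_arcs_le_of_minimallyStrong hsK hminK hnodigK hm3
  have hcount := card_arcs_minorZero_add_four hp hu hp12 hu12
  rw [← hKdef] at hcount
  -- `|arcs of D(G, M)| = 2 (m + 1)`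
  have hout_card : ∀ x, (Finset.univ.filter fun w => IsArc G x w).card = 2 := fun x => by
    obtain ⟨q₁, q₂, hq, hiff⟩ := hout x
    exact card_filter_isArc_eq_two hq hiff
  have htotal := card_filter_fst_mem hout_card (Finset.univ : Finset (Fin (m + 1)))
  have hcongr : (Finset.univ.filter fun e : Fin (m + 1) × Fin (m + 1) => IsArc G e.1 e.2 ∧ e.1 ∈ Finset.univ) =
      Finset.univ.filter fun e : Fin (m + 1) × Fin (m + 1) => IsArc G e.1 e.2 := by
    ext e; simp
  rw [hcongr, Finset.card_univ, Fintype.card_fin] at htotal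
  omega

/-- **No vertex of the digon-free digraph of a minimal non-Pfaffian `G ⊇ diagonal` with all
degrees `≥ 3` is a non-cut vertex** (move it to `0` by a simultaneous relabelling of rows and
columns, under which all hypotheses are invariant, and apply `false_of_nonCut_zero`).
[cite: Little1975, Theorem 1] -/
theorem false_of_nonCut (hdiag : ∀ i, (i, i) ∈ G) (hG : ¬ IsPfaffianBipartite G)
    (hdel : ∀ e ∈ G, IsPfaffianBipartite (G.erase e))
    (hcen : ∀ (k : ℕ) (K : Finset (Fin k × Fin k)), k < m + 1 → IsCentralSubgraph K G →
      IsPfaffianBipartite K)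
    (hrow : ∀ i, 3 ≤ (G.filter fun e : Fin (m + 1) × Fin (m + 1) => e.1 = i).card)
    (hcol : ∀ j, 3 ≤ (G.filter fun e : Fin (m + 1) × Fin (m + 1) => e.2 = j).card)
    (hnodig : ∀ u v, IsArc G u v → ¬ IsArc G v u) {y : Fin (m + 1)}
    (hy : ∀ a b : Fin (m + 1), a ≠ y → b ≠ y →
      Relation.ReflTransGen (fun c d => IsArc G c d ∧ c ≠ y ∧ d ≠ y) a b) : False := by
  classical
  set ρ : Perm (Fin (m + 1)) := swap 0 y with hρ
  have hρs : ρ.symm = ρ := by rw [hρ, Equiv.symm_swap]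
  have hρρ : ∀ x, ρ (ρ x) = x := fun x => by rw [hρ, swap_apply_self]
  have hρ0 : ρ 0 = y := by rw [hρ, swap_apply_left]
  set G' := relabel G ρ ρ with hG'
  have hmem' : ∀ e : Fin (m + 1) × Fin (m + 1), e ∈ G' ↔ (ρ e.1, ρ e.2) ∈ G := fun e => by
    rw [hG', mem_relabel_iff, hρs]
  have harc' : ∀ a b, IsArc G' a b ↔ IsArc G (ρ a) (ρ b) := fun a b =>
    ⟨fun h => ⟨fun heq => h.1 (ρ.injective heq), (hmem' _).1 h.2⟩,
      fun h => ⟨fun heq => h.1 (by rw [heq]), (hmem' _).2 h.2⟩⟩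
  refine false_of_nonCut_zero (G := G') (fun i => (hmem' _).2 (hdiag _))
    (fun h => hG ((isIsomorphic_relabel G ρ ρ).isPfaffianBipartite_iff.2 h)) (fun e he => ?_)
    (fun k K hk hK => hcen k K hk ?_) (fun i => ?_) (fun j => ?_)
    (fun u v huv hvu => hnodig _ _ ((harc' _ _).1 huv) ((harc' _ _).1 hvu)) (fun a b ha hb => ?_)
  · -- deletion
    have hrel : G'.erase e = relabel (G.erase (ρ e.1, ρ e.2)) ρ ρ := by
      rw [relabel_erase, hρρ, hρρ]
    rw [hrel]
    exact (isIsomorphic_relabel _ _ _).isPfaffianBipartite (hdel _ ((hmem' e).1 he))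
  · -- central subgraphs
    have h := hK.relabel_host ρ.symm ρ.symm
    rwa [hG', relabel_relabel_symm] at h
  · have h := card_filter_fst_relabel G ρ ρ (ρ i)
    simp only [hρρ] at h
    rw [hG', h]
    exact hrow (ρ i)
  · have h := card_filter_snd_relabel G ρ ρ (ρ j)
    simp only [hρρ] at h
    rw [hG', h]
    exact hcol (ρ j)
  · -- the non-cut vertex `y` becomes `0`
    have hay : ρ a ≠ y := fun h => ha (by rw [← hρρ a, h, ← hρ0, hρρ])
    have hby : ρ b ≠ y := fun h => hb (by rw [← hρρ b, h, ← hρ0, hρρ])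
    have h := reflTransGen_map (r := fun c d => IsArc G c d ∧ c ≠ y ∧ d ≠ y)
      (p := fun c d => IsArc G' c d ∧ c ≠ 0 ∧ d ≠ 0) ρ (fun c d hcd => ?_) (hy _ _ hay hby)
    · rwa [hρρ, hρρ] at h
    · obtain ⟨hcd, hc, hd⟩ := hcd
      refine ⟨(harc' _ _).2 (by rw [hρρ, hρρ]; exact hcd), fun h0 => hc ?_, fun h0 => hd ?_⟩
      · rw [← hρρ c, h0, hρ0]
      · rw [← hρρ d, h0, hρ0]

end MinorZero

/-! ### The core and the discharge -/

/-- **The CORE of Little's theorem**: a non-Pfaffian `G ⊇ diagonal` all of whose one-edge-deleted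
subgraphs and proper central subgraphs are Pfaffian and all of whose rows and columns have at
least three entries has a `K_{3,3}` matching minor — in fact is `K_{3,3}` (Little 1975, Thm 1:
"a minimal non-Pfaffian bipartite graph is `K_{3,3}`"). Either `D(G, M)` has a digon
(`isMatchingMinor_of_digon`), or some vertex is not a cut vertex (`exists_digon_or_nonCutVertex`),
which is impossible (`false_of_nonCut`). [cite: Little1975, Theorem 1] -/
theorem core_holds (n : ℕ) (G : Finset (Fin n × Fin n)) (hdiag : ∀ i, (i, i) ∈ G)
    (hG : ¬ IsPfaffianBipartite G) (hdel : ∀ e ∈ G, IsPfaffianBipartite (G.erase e))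
    (hcen : ∀ (k : ℕ) (K : Finset (Fin k × Fin k)), k < n → IsCentralSubgraph K G →
      IsPfaffianBipartite K)
    (hrow : ∀ i, 3 ≤ (G.filter fun e => e.1 = i).card)
    (hcol : ∀ j, 3 ≤ (G.filter fun e => e.2 = j).card) :
    IsMatchingMinor (Finset.univ : Finset (Fin 3 × Fin 3)) G := by
  classical
  have hn3 : 3 ≤ n := by
    by_contra hlt
    exact hG (isPfaffianBipartite_of_lt_three (not_le.1 hlt) G)
  obtain ⟨m, rfl⟩ : ∃ m, n = m + 1 := ⟨n - 1, by omega⟩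
  by_cases hdig : ∃ u v, IsArc G u v ∧ IsArc G v u
  · obtain ⟨u, v, huv, hvu⟩ := hdig
    exact isMatchingMinor_of_digon hdiag hG hdel hrow huv hvu
  · have hnodig : ∀ u v, IsArc G u v → ¬ IsArc G v u := fun u v huv hvu => hdig ⟨u, v, huv, hvu⟩
    obtain ⟨hs, hrem, hout, hin⟩ := core_digraph_facts hdiag hG hdel hrow hcol
    have hout_card : ∀ x, (Finset.univ.filter fun w => IsArc G x w).card = 2 := fun x => by
      obtain ⟨q₁, q₂, hq, hiff⟩ := hout x
      exact card_filter_isArc_eq_two hq hiff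
    have hin_card : ∀ x, (Finset.univ.filter fun w => IsArc G w x).card = 2 := fun x => by
      obtain ⟨q₁, q₂, hq, hiff⟩ := hin x
      exact card_filter_isArc_in_eq_two hq hiff
    rcases exists_digon_or_nonCutVertex hs hrem hout_card hin_card hn3 with ⟨u, v, huv, hvu⟩ | ⟨y, hy⟩
    · exact absurd hvu (hnodig u v huv)
    · exact (false_of_nonCut hdiag hG hdel hcen hrow hcol hnodig hy).elim

/-- **Little's theorem** (Little 1975, Theorem 1 with Robertson–Seymour–Thomas (1.2)/(4.2)): a
bipartite graph is Pfaffian if and only if it has no matching minor isomorphic to `K_{3,3}`. The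
discharge of the named fact `Little1975_isPfaffianBipartite_iff_not_isMatchingMinor`: the easy
direction is `MatchingMinorPfaffian.lean`, the hard direction is `little1975_of_core` applied to
`core_holds`. [cite: Little1975, Theorem 1; RobertsonSeymourThomas1999, (1.2)] -/
theorem Little1975_isPfaffianBipartite_iff_not_isMatchingMinor_holds :
    Little1975_isPfaffianBipartite_iff_not_isMatchingMinor :=
  little1975_of_core core_holds

end Literature.Combinatorics.SimpleGraph
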